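import Mathlib.Geometry.Manifold.Diffeomorph
import Mathlib.Geometry.Manifold.IntegralCurve.Basic
import Literature.Geometry.Lorentzian.Basic
import Literature.Geometry.Lorentzian.Einstein
import Literature.Geometry.Lorentzian.LeviCivitaProofs
import Literature.Geometry.Lorentzian.CausalityPushUp
import Literature.Geometry.Lorentzian.ConvergenceTransport
import HarnessLib

/-!
# Self-similar vacuum spacetimes with a vertex (homothetic fields, discrete homotheties,
# continuously / discretely self-similar vacuum profiles)

A `3+1`-dimensional Lorentzian manifold `(M, g)` is a **self-similar solution of the Einstein
vacuum equations** if `Ric(g) = 0` and it possesses a **homothetic vector field** `K`,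
`𝓛_K g = 2g` (Shlapentokh-Rothman, CMP 401 (2023), §1, (1.1)–(1.2); the notion of a homothetic
field goes back to Cahill–Taub and is the *continuous self-similarity* (CSS) of the
critical-collapse literature, Gundlach–Martín-García, Living Rev. Relativ. 10 (2007), §2.2). The
*discrete self-similarity* (DSS) of Gundlach, Phys. Rev. D 55 (1997), §2.2, asks instead for a
diffeomorphism `Φ` and a constant `Δ` with `Φ^* g = e^{2Δ} g` (a discrete homothety); CSS is the
degenerate case of DSS in which `Φ` is the time-`Δ` map of the flow of `K` ("CSS corresponds to
DSS for infinitesimally small `Δ`, and hence for all `Δ`", loc. cit.).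

This file provides

* `PseudoRiemannianMetric.IsHomotheticField g c X` — `X` is `C^n` and
  `g(∇_Y X, Z) + g(Y, ∇_Z X) = 2c·g(Y, Z)` (i.e. `𝓛_X g = 2c g`; `c = 0` is
  `IsKillingField`, `c = 1` the normalisation `𝓛_K g = 2g` of the sources);
* `PseudoRiemannianMetric.IsHomothety g s Φ` — `Φ^* g = e^{2s} g` (a homothety of log-scale
  `s`; `s = Δ` in Gundlach's DSS, `a = e^s` in Christodoulou's `f_a^* g = a² g`,
  Ann. Math. 140 (1994), as restated in Rodnianski–Shlapentokh-Rothman, Ann. Math. 198 (2023),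
  Def. 1.2);
* the hypothesis structure `SelfSimilarVacuumProfile n` — a **continuously or discretely
  self-similar vacuum spacetime with vertex and regular vertex past cone**, the object the
  blow-up ("tangent profile") analysis of naked singularities is about: a time-oriented
  Lorentzian `4`-manifold with a `C^n` metric (`1 ≤ n`), a time-orientation preserving discrete
  homothety `Φ` of log-scale `Δ > 0`, an *optical function* `v` cutting out the chronological
  past `P = {v < 0}` of the (ideal, absent) **vertex** and its **past null cone** `𝒩 = {v = 0}`
  (a smooth null hypersurface of `M`), the metric being `C^∞` off `𝒩` and Ricci-flat; the
  differentiability class `n` of `g` *across* `𝒩` is the parameter (`n = ∞`: "regular horizon",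
  `toSpacetime`; `n = 1` with `IsHolderAcrossCone α`: the "threshold-kinked" class `C^{1,α}` of
  the known vacuum examples, Rodnianski–Shlapentokh-Rothman 2023, Thm. 1: `g ∈ C^N(M ∖ 𝒩) ∩
  C^{1,cε²}(M)`);
* the predicates `IsNonflat` (curvature does not vanish identically off the cone),
  `IsContinuouslySelfSimilar` (there is a homothetic field `K`, `𝓛_K g = 2g`, with global
  integral curves whose time-`Δ` map is `Φ`), and the refinement structure
  `ContinuouslySelfSimilarVacuumProfile n` carrying `K` as data;
* API (all proved): inverses/compositions of homotheties (`IsHomothety.symm`, `.comp`),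
  time-orientation preserving homotheties preserve future-directedness, future timelike curves and
  `≪` (`IsHomothety.isFutureDirected_mfderiv`, `.isFutureTimelikeCurveOn_comp`,
  `.mem_chronologicalFuture_apply`, `.preservesTimeOrientation_symm`); for profiles: `P` is an open
  past set (`isOpen_past`, `mem_past_of_mem_chronologicalFuture`, `chronologicalPast_subset_past`),
  `Φ(P) = P` (`dilation_mem_past_iff`, `image_dilation_past`, `image_dilation_closure_past`),
  `∂P ⊆ 𝒩` (`frontier_past_subset_cone`), `dv ≠ 0` on `𝒩`, `isRicciFlat` (for `C²` metrics),
  the `Spacetime 4` of a smooth profile (`toSpacetime`).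

## Design choices (what is *not* printed, and why it is rendered this way)

* **Regularity as the parameter `n`.** The tree's `Spacetime 4` has a `C^∞` metric, but the only
  vacuum naked-singularity spacetimes known (RSR 2023, Thm. 1; Shlapentokh-Rothman
  arXiv:2204.09891) are merely `C^{1,α}` across the past cone of the singular point, and
  Shlapentokh-Rothman 2023, Def. 4.1 explicitly allows limited regularity of `g` across the null
  hypersurface `𝓗₀` to which `K` is tangent. Hence the profile is a `LorentzianManifold 4 n` with
  `[Fact (1 ≤ n)]` (the Levi-Civita idiom of `LeviCivita.lean`), smooth off the cone
  (`contMDiffOn_metric`), with the finer Hölder information as the predicate `IsHolderAcrossCone`.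
* **Self-similarity as a discrete homothety.** "Continuously *or* discretely self-similar" is
  the inclusive DSS notion (Gundlach 1997: CSS is a degenerate case of DSS), so the structure
  carries `(Φ, Δ)`; CSS is the predicate/refinement supplying `K` with `Φ = φ_Δ`. Completeness of
  the `K`-orbits (Shlapentokh-Rothman 2023, Def. 4.1) is witnessed by *global* integral curves
  (in particular the orbits are complete towards the past, i.e. towards large scales, and
  towards the vertex); the `Φ`-orbits `(Φ^k x)_{k ∈ ℤ}` of a profile are bi-infinite by fiat.
* **The vertex is an ideal point.** It is not a point of `M` (RSR 2023: "the point `𝒪` is not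
  included in the spacetime"); it is encoded through its chronological past: the axiom
  `setOf_coneFn_neg_eq` says `{v < 0}` is *exactly* the set of events `x` such that every orbit
  of the contraction `Φ⁻¹` eventually enters `I⁺(x)` — the chronological past of the common
  future end of all `Φ`-orbits. For Minkowski space minus the origin with `Φ x = e^Δ x` this set
  is `I⁻(0)`, and the axiom rules out the impostors `M ∖ J⁺(0)` (bounded by the *future* cone) and
  the dilation-invariant null half-spaces. Weaker-looking alternatives are wrong for the twisted
  solutions: `K` is spacelike on part of the cone there (Shlapentokh-Rothman 2023, Rem. 4.3), so
  neither "`Φ x ≪ x` on `P`" nor "`Φ⁻¹` moves points of `𝒩` causally" holds (the flow winds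
  around the null generators).
* **The cone as a regular level set.** `𝒩 = {v = 0}` with `v` continuous, `C^∞` near `𝒩`, and
  `ker dv_x = L^⊥` for a null vector `L` at each `x ∈ 𝒩` (so `dv_x ≠ 0` and `T_x 𝒩` is a null
  hyperplane with null generator `L`): a smooth embedded null hypersurface, as in the double-null
  descriptions `{v = 0}` of the sources. Which smooth function `v` is chosen is immaterial
  (only its sign pattern and zero set enter).
* **Vacuum.** `Ric(g) = 0` is imposed at every point off the cone, and everywhere when `2 ≤ n`
  (for `n = 1` the curvature of the tree is not meaningful at points where `g` is not `C²`).
* `IsNonflat` is a predicate, not a field: Minkowski space minus a point *is* a (flat) profile.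
* No claim is made here that the examples of the literature satisfy the axioms beyond the
  informal verification recorded in the docstrings; the structure is a hypothesis structure in the
  sense of `FinalStateDecomposition` (`KerrConvergence.lean`).

## References

* Y. Shlapentokh-Rothman, *Twisted self-similarity and the Einstein vacuum equations*, Comm.
  Math. Phys. 401 (2023) 2269–2325 = arXiv:2205.11715, §1 (1.1)–(1.2), Def. 4.1, Rem. 4.3.
* I. Rodnianski, Y. Shlapentokh-Rothman, *Naked singularities for the Einstein vacuum
  equations: the exterior solution*, Ann. of Math. 198 (2023) 231–391 = arXiv:1912.08478,
  Def. 1.2 (k-self-similarity), Def. 2.3, Def. 3.1, Thm. 1, §1.4 (Fefferman–Graham solutions).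
* C. Gundlach, *Understanding critical collapse of a scalar field*, Phys. Rev. D 55 (1997)
  695–713 = gr-qc/9604019, §2.2 (CSS, DSS).
* C. Gundlach, J. M. Martín-García, *Critical phenomena in gravitational collapse*, Living Rev.
  Relativ. 10 (2007) 5, §2.2.
* B. O'Neill, *Semi-Riemannian geometry*, 1983, Ch. 9, Def. 9.22 ff. (Killing fields), Ch. 14
  (causality).
-/

noncomputable section

open Bundle Set Function Filter
open scoped Manifold ContDiff Topology NNReal

namespace Literature.Geometry.Lorentzian

variable {E : Type*} [NormedAddCommGroup E] [NormedSpace ℝ E] {H : Type*} [TopologicalSpace H]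
  {I : ModelWithCorners ℝ E H} {M : Type*} [TopologicalSpace M] [ChartedSpace H M]
  [IsManifold I ∞ M] {n : ℕ∞ω}

/-! ### Homothetic vector fields -/

namespace PseudoRiemannianMetric

section HomotheticField

variable [FiniteDimensional ℝ E] [CompleteSpace E] [Fact (1 ≤ n)]
  (g : PseudoRiemannianMetric I n E (TangentSpace I : M → Type _)) [g.HasLeviCivita]

/-- A vector field `X` on `M` is a **homothetic vector field** of `g` with homothety constant
`c : ℝ` if it is `C^n` (as a section of `TM`) and `g(∇_Y X, Z) + g(Y, ∇_Z X) = 2c·g(Y, Z)` for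
all tangent vectors `Y, Z` at every point, i.e. `𝓛_X g = 2c·g` (recall Mathlib's argument order
`cov X x Y₀ = ∇_{Y₀} X`). For `c = 0` this is the Killing equation (`isHomotheticField_zero_iff`);
`c ≠ 0` is a *proper* homothety, and `c = 1` the normalisation `𝓛_K g = 2g` of the self-similar
literature. Gundlach–Martín-García 2007, §2.2 ("a CSS spacetime is one that admits a homothetic
vector field `ξ`, `𝓛_ξ g_{ab} = 2g_{ab}`", after Cahill–Taub); Shlapentokh-Rothman 2023, §1,
(1.2). [cite: GundlachMartingarcia2007, §2.2] -/
def IsHomotheticField (c : ℝ) (X : Π x : M, TangentSpace I x) : Prop :=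
  CMDiff n (T% X) ∧
    ∀ (x : M) (Y₀ Z₀ : TangentSpace I x),
      g.val x (g.leviCivita X x Y₀) Z₀ + g.val x Y₀ (g.leviCivita X x Z₀) = 2 * c * g.val x Y₀ Z₀

variable {g}

omit [FiniteDimensional ℝ E] [CompleteSpace E] [Fact (1 ≤ n)] in
/-- A homothetic field is `C^n`. Gundlach–Martín-García 2007, §2.2. [cite: GundlachMartingarcia2007, §2.2] -/
lemma IsHomotheticField.contMDiff {c : ℝ} {X : Π x : M, TangentSpace I x}
    (h : g.IsHomotheticField c X) : CMDiff n (T% X) := h.1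

omit [FiniteDimensional ℝ E] [CompleteSpace E] [Fact (1 ≤ n)] in
/-- The homothetic Killing equation `g(∇_Y X, Z) + g(Y, ∇_Z X) = 2c·g(Y, Z)`.
Gundlach–Martín-García 2007, §2.2. [cite: GundlachMartingarcia2007, §2.2] -/
lemma IsHomotheticField.val_leviCivita_add {c : ℝ} {X : Π x : M, TangentSpace I x}
    (h : g.IsHomotheticField c X) (x : M) (Y₀ Z₀ : TangentSpace I x) :
    g.val x (g.leviCivita X x Y₀) Z₀ + g.val x Y₀ (g.leviCivita X x Z₀) = 2 * c * g.val x Y₀ Z₀ :=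
  h.2 x Y₀ Z₀

omit [FiniteDimensional ℝ E] [CompleteSpace E] [Fact (1 ≤ n)] in
/-- The diagonal form of the homothetic equation: `g(∇_Y X, Y) = c·g(Y, Y)` (so along a geodesic
`γ`, `g(X, γ')' = c·g(γ', γ')`). Gundlach–Martín-García 2007, §2.2. [cite: GundlachMartingarcia2007, §2.2] -/
lemma IsHomotheticField.val_leviCivita_self {c : ℝ} {X : Π x : M, TangentSpace I x}
    (h : g.IsHomotheticField c X) (x : M) (Y₀ : TangentSpace I x) :
    g.val x (g.leviCivita X x Y₀) Y₀ = c * g.val x Y₀ Y₀ := by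
  have h2 := h.2 x Y₀ Y₀
  rw [g.symm x Y₀ (g.leviCivita X x Y₀)] at h2
  linarith

omit [FiniteDimensional ℝ E] [CompleteSpace E] [Fact (1 ≤ n)] in
variable (g) in
/-- Homothetic with constant `0` is Killing (`𝓛_X g = 0`). O'Neill 1983, Ch. 9, Def. 9.22 and
Prop. 9.25. [cite: ONeill1983, Ch. 9, Def. 9.22 and Prop. 9.25] -/
lemma isHomotheticField_zero_iff (X : Π x : M, TangentSpace I x) :
    g.IsHomotheticField 0 X ↔ g.IsKillingField X := by
  simp [IsHomotheticField, IsKillingField]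

end HomotheticField

/-! ### Homotheties (discrete conformal isometries with constant factor) -/

section Homothety

variable (g : PseudoRiemannianMetric I n E (TangentSpace I : M → Type _))

/-- A map `Φ : M → M` is a **homothety of log-scale `s`** of `g` if `Φ^* g = e^{2s} g`, i.e.
`g_{Φ y}(dΦ v, dΦ w) = e^{2s} g_y(v, w)` for all tangent vectors: a (positive) homothety of
coefficient `c = e^{2s}` and scale factor `e^s` in the sense of O'Neill 1983, Ch. 3, Def. 3.63
(`ψ^* g_N = c g_M`), here for self-maps and without requiring `Φ` to be a diffeomorphism. With
`s = Δ` this is the defining relation `φ^* g_{ab} = e^{2Δ} g_{ab}` of discrete self-similarity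
(Gundlach 1997, §2.2); with `a = e^s` it is `f_a^* g = a² g` (Christodoulou's k-self-similarity,
RSR 2023, Def. 1.2); `s = 0` is an isometry (`isHomothety_zero_iff`). No connection is needed to
state it. [cite: ONeill1983, Ch. 3, Def. 3.63] -/
def IsHomothety (s : ℝ) (Φ : M → M) : Prop :=
  ∀ y, pullbackBilin (I := I) (I' := I) Φ g.val y = Real.exp (2 * s) • g.val y

variable {g} in
/-- Pointwise form of `IsHomothety`: `g(dΦ v, dΦ w) = e^{2s} g(v, w)`. Gundlach 1997, §2.2. [cite: Gundlach1997, §2.2] -/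
lemma IsHomothety.val_mfderiv {s : ℝ} {Φ : M → M} (h : g.IsHomothety s Φ) (y : M)
    (v w : TangentSpace I y) :
    g.val (Φ y) (mfderiv I I Φ y v) (mfderiv I I Φ y w) = Real.exp (2 * s) * g.val y v w := by
  have := congrArg (fun b ↦ b v w) (h y)
  simpa only [pullbackBilin_apply, FunLike.coe_smul, Pi.smul_apply,
    smul_eq_mul] using this

/-- Log-scale `0` homotheties are exactly the maps with `Φ^* g = g` (isometric). O'Neill 1983,
Ch. 3, p. 58. [cite: ONeill1983, Ch. 3, p. 58] -/
lemma isHomothety_zero_iff (Φ : M → M) :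
    g.IsHomothety 0 Φ ↔ ∀ y, pullbackBilin (I := I) (I' := I) Φ g.val y = g.val y := by
  simp [IsHomothety]

/-- The identity is a homothety of log-scale `0`. O'Neill 1983, Ch. 3, p. 58. [cite: ONeill1983, Ch. 3, p. 58] -/
lemma isHomothety_zero_id : g.IsHomothety 0 (id : M → M) := by
  intro y
  simp [pullbackBilin_id]

omit [IsManifold I ∞ M] in
/-- Pullback commutes with a constant rescaling of the family of forms. [folklore] -/
lemma pullbackBilin_const_smul (Φ : M → M) (a : ℝ)
    (b : Π x : M, TangentSpace I x →L[ℝ] TangentSpace I x →L[ℝ] ℝ) (y : M) :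
    pullbackBilin (I := I) (I' := I) Φ (fun z ↦ a • b z) y =
      a • pullbackBilin (I := I) (I' := I) Φ b y := by
  ext v w
  simp [pullbackBilin_apply]

variable {g} in
/-- **Log-scales add under composition**: if `Φ^* g = e^{2s} g` and `Ψ^* g = e^{2t} g` (both
differentiable) then `(Φ ∘ Ψ)^* g = e^{2(s+t)} g` (chain rule `pullbackBilin_comp`); in particular
the iterates of a discrete homothety of log-scale `Δ` have log-scales `kΔ`
(Gundlach 1997, §2.2: `(φ_*)^n g = e^{2nΔ} g`). [cite: Gundlach1997, §2.2] -/
theorem IsHomothety.comp {s t : ℝ} {Φ Ψ : M → M} (hΦ : g.IsHomothety s Φ) (hΨ : g.IsHomothety t Ψ)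
    (hΦd : MDifferentiable I I Φ) (hΨd : MDifferentiable I I Ψ) :
    g.IsHomothety (s + t) (Φ ∘ Ψ) := by
  intro y
  rw [pullbackBilin_comp hΦd hΨd, show pullbackBilin (I := I) (I' := I) Φ g.val =
    fun z ↦ Real.exp (2 * s) • g.val z from funext hΦ, pullbackBilin_const_smul, hΨ y, smul_smul,
    ← Real.exp_add]
  ring_nf

end Homothety

end PseudoRiemannianMetric

/-! ### Homotheties of time-oriented Lorentzian manifolds preserve the causal structure -/

namespace PseudoRiemannianMetric.IsHomothety

variable {g : LorentzianMetric I n M} {τ : TimeOrientation g} {s : ℝ}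

/-- **The inverse of a homothety of log-scale `s` is a homothety of log-scale `-s`**
(`id^* g = (Φ ∘ Φ⁻¹)^* g = Φ⁻¹^* (e^{2s} g)`). Gundlach 1997, §2.2 (`(φ_*)^n g = e^{2nΔ} g` for all
integers `n`). [cite: Gundlach1997, §2.2] -/
theorem symm {m : ℕ∞ω} {Φ : Diffeomorph I I M M m} (hΦ : g.IsHomothety s Φ) (hm : m ≠ 0) :
    g.IsHomothety (-s) Φ.symm := by
  intro y
  have hcomp := pullbackBilin_comp (I := I) (I' := I) (I'' := I) (f := Φ.symm) (g := Φ)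
    (Φ.mdifferentiable hm) (Φ.symm.mdifferentiable hm) g.val
  rw [show ((Φ : M → M) ∘ Φ.symm) = id from funext Φ.apply_symm_apply, pullbackBilin_id,
    show pullbackBilin (I := I) (I' := I) Φ g.val = fun z ↦ Real.exp (2 * s) • g.val z from
      funext hΦ] at hcomp
  have hy := congrFun hcomp y
  rw [pullbackBilin_const_smul] at hy
  rw [hy, smul_smul, ← Real.exp_add, show 2 * -s + 2 * s = 0 by ring, Real.exp_zero, one_smul]

/-- **The differential of a time-orientation preserving homothety maps future-directed vectors
to future-directed vectors** (`g(dΦ u, dΦ w) = e^{2s} g(u, w)`: a positive homothety preserves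
causal character, O'Neill 1983, Ch. 3, Remark 3.65 (3); then the timecone lemma, Ch. 5, p. 145
with Lemma 5.29). [cite: ONeill1983, Ch. 3, Remark 3.65 (3) and Ch. 5, p. 145] -/
theorem isFutureDirected_mfderiv {Φ : M → M} (hΦ : g.IsHomothety s Φ)
    (hτ : τ.PreservesTimeOrientation Φ τ) {y : M} {v : TangentSpace I y}
    (hv : τ.IsFutureDirected v) : τ.IsFutureDirected (mfderiv I I Φ y v) := by
  have key := hΦ.val_mfderiv y
  have hpos : 0 < Real.exp (2 * s) := Real.exp_pos _
  have hT : g.IsTimelike (mfderiv I I Φ y (τ.vectorField y)) := by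
    rw [LorentzianMetric.isTimelike_iff, key]
    exact mul_neg_of_pos_of_neg hpos (τ.isTimelike y)
  have hvc : g.IsCausal (mfderiv I I Φ y v) := by
    refine ⟨?_, fun h0 ↦ hv.1.2 ?_⟩
    · rw [key]
      exact mul_nonpos_iff.mpr (Or.inl ⟨hpos.le, hv.1.1⟩)
    · apply g.nondegenerate y v
      intro w
      have hw := key v w
      rw [h0, map_zero] at hw
      change (0 : ℝ) = _ at hw
      exact (mul_eq_zero.mp hw.symm).resolve_left hpos.ne'
  refine τ.isFutureDirected_of_val_lt_zero (hτ y) hT hvc ?_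
  rw [key]
  exact mul_neg_of_pos_of_neg hpos hv.2

/-- **A time-orientation preserving homothetic diffeomorphism has a time-orientation preserving
inverse**: `dΦ⁻¹ T` is timelike, and were it past-directed, `dΦ(−dΦ⁻¹ T) = −T` would be
future-directed. O'Neill 1983, Ch. 5, p. 145. [cite: ONeill1983, Ch. 5, p. 145] -/
theorem preservesTimeOrientation_symm {m : ℕ∞ω} {Φ : Diffeomorph I I M M m}
    (hΦ : g.IsHomothety s Φ) (hm : m ≠ 0) (hτ : τ.PreservesTimeOrientation Φ τ) :
    τ.PreservesTimeOrientation Φ.symm τ := by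
  intro y
  set u := mfderiv I I Φ.symm y (τ.vectorField y) with hu
  have hut : g.IsTimelike u := by
    rw [LorentzianMetric.isTimelike_iff, hu, (hΦ.symm hm).val_mfderiv]
    exact mul_neg_of_pos_of_neg (Real.exp_pos _) (τ.isTimelike y)
  rcases τ.isFutureDirected_or_isPastDirected_of_isCausal hut.isCausal with h | h
  · exact h
  · exfalso
    have hneg : τ.IsFutureDirected (-u) := (τ.isFutureDirected_neg_iff u).mpr h
    have himg := hΦ.isFutureDirected_mfderiv hτ hneg
    have hchain : mfderiv I I Φ (Φ.symm y) u = τ.vectorField y := by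
      have hc := mfderiv_comp y (Φ.mdifferentiable hm (Φ.symm y)) (Φ.symm.mdifferentiable hm y)
      rw [show ((Φ : M → M) ∘ Φ.symm) = id from funext Φ.apply_symm_apply, mfderiv_id] at hc
      exact (DFunLike.congr_fun hc (τ.vectorField y)).symm
    rw [map_neg, hchain, Φ.apply_symm_apply] at himg
    exact τ.not_isPastDirected_of_isFutureDirected (τ.isFutureDirected_vectorField y)
      ((τ.isFutureDirected_neg_iff _).mp himg)

/-- **Time-orientation preserving homotheties carry future timelike curves to future timelike
curves** (chain rule for the velocity; `g(dΦ γ', dΦ γ') = e^{2s} g(γ', γ') < 0`). O'Neill 1983,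
Ch. 3, Remark 3.65 (3) ("a homothety of coefficient `c > 0` preserves causal character of tangent
vectors (hence of curves)"). [cite: ONeill1983, Ch. 3, Remark 3.65 (3)] -/
theorem isFutureTimelikeCurveOn_comp {Φ : M → M} (hΦ : g.IsHomothety s Φ)
    (hΦd : MDifferentiable I I Φ) (hτ : τ.PreservesTimeOrientation Φ τ) {γ : ℝ → M} {S : Set ℝ}
    (hγ : g.IsFutureTimelikeCurveOn τ γ S) : g.IsFutureTimelikeCurveOn τ (Φ ∘ γ) S := by
  intro t ht
  obtain ⟨hd, htl, hfd⟩ := hγ t ht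
  refine ⟨(hΦd (γ t)).comp t hd, ?_⟩
  have hvel : velocity I (Φ ∘ γ) t = mfderiv I I Φ (γ t) (velocity I γ t) := by
    unfold velocity
    rw [mfderiv_comp t (hΦd (γ t)) hd]
    rfl
  rw [hvel]
  refine ⟨?_, hΦ.isFutureDirected_mfderiv hτ hfd⟩
  have hneg : Real.exp (2 * s) * g.val (γ t) (velocity I γ t) (velocity I γ t) < 0 :=
    mul_neg_of_pos_of_neg (Real.exp_pos _) htl
  rw [← hΦ.val_mfderiv (γ t) (velocity I γ t) (velocity I γ t)] at hneg
  exact hneg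

/-- **Homotheties preserve the chronological relation**: `y ∈ I⁺(x) ⟹ Φ y ∈ I⁺(Φ x)` for a
time-orientation preserving homothety `Φ`. O'Neill 1983, Ch. 14, pp. 402–403. [cite: ONeill1983, Ch. 14, pp. 402–403] -/
theorem mem_chronologicalFuture_apply {Φ : M → M} (hΦ : g.IsHomothety s Φ)
    (hΦd : MDifferentiable I I Φ) (hτ : τ.PreservesTimeOrientation Φ τ) {x y : M}
    (hy : y ∈ g.chronologicalFuture τ {x}) : Φ y ∈ g.chronologicalFuture τ {Φ x} := by
  obtain ⟨x₀, hx₀, γ, a, b, hab, hγ, hγa, hγb⟩ := hy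
  rw [mem_singleton_iff] at hx₀
  exact ⟨Φ x, rfl, Φ ∘ γ, a, b, hab, hΦ.isFutureTimelikeCurveOn_comp hΦd hτ hγ,
    by simp [hγa, hx₀], by simp [hγb]⟩

end PseudoRiemannianMetric.IsHomothety

/-! ### Self-similar vacuum spacetimes with vertex -/

-- every `C^n` metric, `1 ≤ n`, has its Levi-Civita connection (`LeviCivitaProofs`); as a local
-- instance so that `ricci`, `IsKillingField`, `IsHomotheticField` elaborate for the bundled metric
attribute [local instance] PseudoRiemannianMetric.hasLeviCivita

universe u

/-- A **continuously or discretely self-similar vacuum spacetime with vertex and regular vertex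
past cone**, of metric regularity `C^n` across the cone (`1 ≤ n`) — a *self-similar vacuum
profile*. Data and axioms:

* a connected Hausdorff second-countable `C^∞` `4`-manifold with a `C^n` Lorentzian metric `g`
  (`toLorentzianManifold`) and a time orientation;
* a **discrete homothety**: a diffeomorphism `Φ = dilation` and a log-scale `Δ = logScale > 0`
  with `Φ^* g = e^{2Δ} g` (Gundlach 1997, §2.2) preserving the time orientation — the inclusive
  form of "continuously or discretely self-similar" (for a homothetic field `K`, `𝓛_K g = 2g`,
  take `Φ` = time-`Δ` flow map; `IsContinuouslySelfSimilar`);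
* an **optical function** `v = coneFn`, continuous, `C^∞` near its zero set, whose zero set
  `𝒩 = {v = 0}` (the **vertex past cone**, `cone`) is nonempty and is a smooth **null**
  hypersurface: at each of its points `ker dv = L^⊥` for a null vector `L` (the null generator);
* the **vertex axiom** `setOf_coneFn_neg_eq`: `P = {v < 0}` (`past`) is exactly the set of
  events `x` such that every orbit of the contraction `Φ⁻¹` eventually enters `I⁺(x)`, i.e. `P`
  is the chronological past of the ideal future endpoint (the **vertex**) of the `Φ`-orbits; the
  vertex itself is not a point of the manifold (RSR 2023, Thm. 1: `u ∈ [−v̲², 0)`; Thm. 1.1: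
  "the point `𝒪` is not included in the spacetime");
* **regularity off the cone**: `g` is `C^∞` on `{v ≠ 0}`;
* **vacuum**: `Ric(g) = 0` off the cone, and everywhere if `2 ≤ n`.

Sources: Shlapentokh-Rothman 2023, §1, (1.1)–(1.2) (self-similar vacuum solution: `Ric = 0`,
`𝓛_K g = 2g`) and Def. 4.1 (complete orbits, null hypersurface `𝓗₀` with `K` tangent, limited
regularity across it); Gundlach 1997, §2.2 (DSS `φ^* g = e^{2Δ} g`); Rodnianski–Shlapentokh-Rothman
2023, Thm. 1 and §1.4 (the examples: twisted self-similar exteriors, `C^{1,cε²}` across the cone;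
Fefferman–Graham self-similar solutions, `K` normal to the cone). The packaging (ideal vertex via
the orbit/chronology axiom, optical function, regularity parameter) is this file's; see the
module docstring. [cite: ShlapentokhRothman2023twisted, §1 (1.1)–(1.2) and Def. 4.1] -/
structure SelfSimilarVacuumProfile (n : ℕ∞ω) [Fact (1 ≤ n)] extends LorentzianManifold.{u} 4 n where
  /-- The time orientation. -/
  timeOrientation : TimeOrientation metric
  /-- The log-scale `Δ` of the discrete homothety. -/
  logScale : ℝ
  /-- `Δ > 0`: the self-similarity is non-trivial. -/
  logScale_pos : 0 < logScale
  /-- The discrete homothety `Φ` (a `C^∞` diffeomorphism of the carrier): an *expansion* by the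
  factor `e^Δ`. -/
  dilation : Diffeomorph (𝓡 4) (𝓡 4) carrier carrier ∞
  /-- `Φ^* g = e^{2Δ} g`. -/
  isHomothety_dilation : metric.IsHomothety logScale dilation
  /-- `Φ` preserves the time orientation. -/
  preservesTimeOrientation_dilation :
    timeOrientation.PreservesTimeOrientation dilation timeOrientation
  /-- The optical function `v`: `{v < 0}` is the past of the vertex, `{v = 0}` its past null cone,
  `{0 < v}` the exterior. -/
  coneFn : carrier → ℝ
  /-- `v` is continuous. -/
  continuous_coneFn : Continuous coneFn
  /-- `v` is `C^∞` at the points of the cone. -/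
  contMDiffAt_coneFn : ∀ x, coneFn x = 0 → ContMDiffAt (𝓡 4) 𝓘(ℝ, ℝ) ∞ coneFn x
  /-- The cone is a **null** hypersurface: at each of its points the kernel of `dv` is the
  `g`-orthogonal complement of a null vector `L` (the null generator; in particular `dv ≠ 0`). -/
  exists_isNull_of_coneFn_eq_zero : ∀ x, coneFn x = 0 → ∃ L : TangentSpace (𝓡 4) x,
    metric.IsNull L ∧ ∀ w : TangentSpace (𝓡 4) x,
      mfderiv (𝓡 4) 𝓘(ℝ, ℝ) coneFn x w = 0 ↔ metric.val x L w = 0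
  /-- The cone is nonempty (the profile straddles the past null cone of its vertex). -/
  exists_coneFn_eq_zero : ∃ x, coneFn x = 0
  /-- **Vertex axiom**: `{v < 0}` is the chronological past of the common future end of the
  `Φ`-orbits — the set of events `x` such that every orbit of `Φ⁻¹` eventually enters `I⁺(x)`. -/
  setOf_coneFn_neg_eq : {x | coneFn x < 0} =
    {x | ∀ y, ∃ k : ℕ, (dilation.symm)^[k] y ∈ metric.chronologicalFuture timeOrientation {x}}
  /-- The metric is `C^∞` off the cone. -/
  contMDiffOn_metric : ContMDiffOn (𝓡 4) ((𝓡 4).prod 𝓘(ℝ, E4 →L[ℝ] E4 →L[ℝ] ℝ)) ∞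
    (fun x : carrier ↦ TotalSpace.mk' (E4 →L[ℝ] E4 →L[ℝ] ℝ)
      (E := fun y : carrier ↦ TangentSpace (𝓡 4) y →L[ℝ] TangentSpace (𝓡 4) y →L[ℝ] ℝ)
      x (metric.val x)) {x | coneFn x ≠ 0}
  /-- **Vacuum**: `Ric(g) = 0` off the cone, and at every point when the metric is `C²`. -/
  ricci_eq_zero : ∀ x, (coneFn x ≠ 0 ∨ 2 ≤ n) → metric.ricci x = 0

namespace SelfSimilarVacuumProfile

variable {n : ℕ∞ω} [Fact (1 ≤ n)] (Z : SelfSimilarVacuumProfile.{u} n)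

/-- The **chronological past of the vertex** `P = {v < 0}` (by the vertex axiom, the events that
chronologically precede the tail of every `Φ⁻¹`-orbit). RSR 2023, §1.3 / Shlapentokh-Rothman
arXiv:2204.09891 (the interior region `{v < 0}`). [cite: RodnianskiShlapentokhRothman2023, §1.3] -/
def past : Set Z.carrier := {x | Z.coneFn x < 0}

/-- The **vertex past cone** `𝒩 = {v = 0}` (the past null cone of the vertex, minus the vertex):
a smooth null hypersurface of the profile. RSR 2023, Thm. 1 (the cone `{v̂ = 0}`). [cite: RodnianskiShlapentokhRothman2023, Thm. 1] -/
def cone : Set Z.carrier := {x | Z.coneFn x = 0}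

/-- The **exterior region** `{0 < v}` (the complement of the closure of the past of the vertex;
for RSR's solutions the region `{v̂ > 0}` of Thm. 1). [cite: RodnianskiShlapentokhRothman2023, Thm. 1] -/
def exterior : Set Z.carrier := {x | 0 < Z.coneFn x}

/-- Membership in the past of the vertex. [folklore] -/
@[simp] lemma mem_past_iff {x : Z.carrier} : x ∈ Z.past ↔ Z.coneFn x < 0 := Iff.rfl

/-- Membership in the vertex past cone. [folklore] -/
@[simp] lemma mem_cone_iff {x : Z.carrier} : x ∈ Z.cone ↔ Z.coneFn x = 0 := Iff.rfl

/-- Membership in the exterior region. [folklore] -/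
@[simp] lemma mem_exterior_iff {x : Z.carrier} : x ∈ Z.exterior ↔ 0 < Z.coneFn x := Iff.rfl

/-- The past of the vertex is open. [folklore] -/
lemma isOpen_past : IsOpen Z.past := isOpen_lt Z.continuous_coneFn continuous_const

/-- The exterior region is open. [folklore] -/
lemma isOpen_exterior : IsOpen Z.exterior := isOpen_lt continuous_const Z.continuous_coneFn

/-- The vertex past cone is closed. [folklore] -/
lemma isClosed_cone : IsClosed Z.cone := isClosed_eq Z.continuous_coneFn continuous_const

/-- The cone is nonempty. [folklore] -/
lemma cone_nonempty : Z.cone.Nonempty := Z.exists_coneFn_eq_zero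

/-- Past, cone and exterior partition the carrier. [folklore] -/
lemma past_union_cone_union_exterior : Z.past ∪ Z.cone ∪ Z.exterior = univ := by
  ext x
  simp only [mem_union, mem_past_iff, mem_cone_iff, mem_exterior_iff, mem_univ, iff_true]
  rcases lt_trichotomy (Z.coneFn x) 0 with h | h | h
  · exact Or.inl (Or.inl h)
  · exact Or.inl (Or.inr h)
  · exact Or.inr h

/-- `dv ≠ 0` on the cone (the null generator `L` is nonzero and `g` is nondegenerate), so `𝒩` is a
regular level set. [folklore] -/
lemma mfderiv_coneFn_ne_zero {x : Z.carrier} (hx : x ∈ Z.cone) :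
    mfderiv (𝓡 4) 𝓘(ℝ, ℝ) Z.coneFn x ≠ 0 := by
  obtain ⟨L, hL, hker⟩ := Z.exists_isNull_of_coneFn_eq_zero x hx
  intro h0
  apply hL.2
  apply Z.metric.nondegenerate x L
  intro w
  exact (hker w).mp (by rw [h0]; rfl)

/-- **Vertex axiom, membership form**: `x` is in the past of the vertex iff every orbit of the
contraction `Φ⁻¹` eventually enters `I⁺(x)`. [cite: ShlapentokhRothman2023twisted, Def. 4.1] -/
lemma mem_past_iff_forall_exists_iterate {x : Z.carrier} :
    x ∈ Z.past ↔ ∀ y, ∃ k : ℕ,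
      (Z.dilation.symm)^[k] y ∈ Z.metric.chronologicalFuture Z.timeOrientation {x} := by
  change x ∈ {x | Z.coneFn x < 0} ↔ _
  rw [Z.setOf_coneFn_neg_eq]
  rfl

/-- **The past of the vertex is a past set**: if `y ∈ P` and `x ≪ y` then `x ∈ P` (transitivity
of `≪`, `mem_chronologicalFuture_trans`). O'Neill 1983, Ch. 14, p. 402. [cite: ONeill1983, Ch. 14, p. 402] -/
theorem mem_past_of_mem_chronologicalFuture {x y : Z.carrier} (hy : y ∈ Z.past)
    (hxy : y ∈ Z.metric.chronologicalFuture Z.timeOrientation {x}) : x ∈ Z.past := by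
  rw [mem_past_iff_forall_exists_iterate] at hy ⊢
  intro z
  obtain ⟨k, hk⟩ := hy z
  exact ⟨k, LorentzianMetric.mem_chronologicalFuture_trans hxy hk⟩

/-- `I⁻(y) ⊆ P` for `y ∈ P` (time dual form of `mem_past_of_mem_chronologicalFuture`).
O'Neill 1983, Ch. 14, pp. 402–403. [cite: ONeill1983, Ch. 14, pp. 402–403] -/
theorem chronologicalPast_subset_past {y : Z.carrier} (hy : y ∈ Z.past) :
    Z.metric.chronologicalPast Z.timeOrientation {y} ⊆ Z.past := fun _ hx ↦
  Z.mem_past_of_mem_chronologicalFuture hy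
    (LorentzianMetric.mem_chronologicalFuture_of_mem_chronologicalPast hx)

/-- **Vacuum**: a profile with a `C²` metric is Ricci-flat everywhere. Shlapentokh-Rothman 2023,
§1, (1.1). [cite: ShlapentokhRothman2023twisted, §1 (1.1)] -/
theorem isRicciFlat (hn : 2 ≤ n) : Z.metric.IsRicciFlat := fun x ↦ Z.ricci_eq_zero x (Or.inr hn)

/-- The Ricci tensor vanishes off the cone (any regularity). Shlapentokh-Rothman 2023, §1, (1.1). [cite: ShlapentokhRothman2023twisted, §1 (1.1)] -/
theorem ricci_eq_zero_of_not_mem_cone {x : Z.carrier} (hx : x ∉ Z.cone) : Z.metric.ricci x = 0 :=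
  Z.ricci_eq_zero x (Or.inl hx)

/-- The metric of a profile has its Levi-Civita connection (every `C^n` metric with `1 ≤ n` does,
`PseudoRiemannianMetric.hasLeviCivita`); registered as an instance so that `Z.metric.ricci`,
`Z.metric.riemann`, `Z.metric.IsKillingField`, … elaborate downstream. [folklore] -/
instance hasLeviCivita_metric : Z.metric.toPseudoRiemannianMetric.HasLeviCivita :=
  Z.metric.hasLeviCivita

/-- The dilation is differentiable. [folklore] -/
lemma mdifferentiable_dilation : MDifferentiable (𝓡 4) (𝓡 4) Z.dilation :=
  Z.dilation.mdifferentiable (by simp)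

/-- The contraction `Φ⁻¹` is a homothety of log-scale `-Δ`. Gundlach 1997, §2.2. [cite: Gundlach1997, §2.2] -/
lemma isHomothety_dilation_symm : Z.metric.IsHomothety (-Z.logScale) Z.dilation.symm :=
  Z.isHomothety_dilation.symm (by simp)

/-- The contraction `Φ⁻¹` preserves the time orientation. O'Neill 1983, Ch. 5, p. 145. [cite: ONeill1983, Ch. 5, p. 145] -/
lemma preservesTimeOrientation_dilation_symm :
    Z.timeOrientation.PreservesTimeOrientation Z.dilation.symm Z.timeOrientation :=
  Z.isHomothety_dilation.preservesTimeOrientation_symm (by simp) Z.preservesTimeOrientation_dilation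

/-- **The past of the vertex is mapped into itself by the dilation.** [cite: ShlapentokhRothman2023twisted, Def. 4.1] -/
theorem dilation_mem_past {x : Z.carrier} (hx : x ∈ Z.past) : Z.dilation x ∈ Z.past := by
  rw [mem_past_iff_forall_exists_iterate] at hx ⊢
  intro y
  obtain ⟨k, hk⟩ := hx (Z.dilation.symm y)
  refine ⟨k, ?_⟩
  have h := Z.isHomothety_dilation.mem_chronologicalFuture_apply Z.mdifferentiable_dilation
    Z.preservesTimeOrientation_dilation hk
  rwa [← iterate_succ_apply, iterate_succ_apply', Diffeomorph.apply_symm_apply] at h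

/-- **The past of the vertex is mapped into itself by the contraction.** [cite: ShlapentokhRothman2023twisted, Def. 4.1] -/
theorem dilation_symm_mem_past {x : Z.carrier} (hx : x ∈ Z.past) : Z.dilation.symm x ∈ Z.past := by
  rw [mem_past_iff_forall_exists_iterate] at hx ⊢
  intro y
  obtain ⟨k, hk⟩ := hx (Z.dilation y)
  refine ⟨k, ?_⟩
  have h := Z.isHomothety_dilation_symm.mem_chronologicalFuture_apply
    (Z.dilation.symm.mdifferentiable (by simp)) Z.preservesTimeOrientation_dilation_symm hk
  rwa [← iterate_succ_apply' Z.dilation.symm k, iterate_succ_apply,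
    Diffeomorph.symm_apply_apply] at h

/-- **Dilation invariance of the past of the vertex**: `Φ x ∈ P ↔ x ∈ P`. [cite: ShlapentokhRothman2023twisted, Def. 4.1] -/
@[simp] theorem dilation_mem_past_iff {x : Z.carrier} : Z.dilation x ∈ Z.past ↔ x ∈ Z.past :=
  ⟨fun h ↦ by simpa using Z.dilation_symm_mem_past h, Z.dilation_mem_past⟩

/-- `Φ(P) = P`. [cite: ShlapentokhRothman2023twisted, Def. 4.1] -/
theorem image_dilation_past : Z.dilation '' Z.past = Z.past := by
  ext x
  constructor
  · rintro ⟨y, hy, rfl⟩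
    exact Z.dilation_mem_past hy
  · intro hx
    exact ⟨Z.dilation.symm x, Z.dilation_symm_mem_past hx, Z.dilation.apply_symm_apply x⟩

/-- The closure of the past of the vertex (`P ∪ 𝒩` when `𝒩 = ∂P`) is dilation invariant.
[cite: ShlapentokhRothman2023twisted, Def. 4.1] -/
theorem image_dilation_closure_past : Z.dilation '' closure Z.past = closure Z.past := by
  have h := Z.dilation.toHomeomorph.image_closure Z.past
  rwa [Diffeomorph.coe_toHomeomorph, image_dilation_past] at h

/-- The frontier of the past of the vertex lies on the cone `{v = 0}`. [folklore] -/
theorem frontier_past_subset_cone : frontier Z.past ⊆ Z.cone :=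
  frontier_lt_subset_eq Z.continuous_coneFn continuous_const

/-- **NONFLAT**: the profile is not locally isometric to Minkowski space, rendered as "the
Riemann tensor does not vanish identically off the cone" (O'Neill 1983, Ch. 3, p. 80: `M` is
*flat* if `R = 0` at every point; for the smooth metric off the cone, flat is equivalent to
locally isometric to `ℝ⁴₁` by Ch. 8, Thm. 8.14). Minkowski space minus a point with `Φ x = e^Δ x`
is a flat profile, excluded by this predicate. [cite: ONeill1983, Ch. 3, p. 80 and Ch. 8, Thm. 8.14] -/
def IsNonflat (Z : SelfSimilarVacuumProfile.{u} n) : Prop :=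
  ∃ x, x ∉ Z.cone ∧ Z.metric.riemann x ≠ 0

/-- **Continuous self-similarity (CSS)**: there is a homothetic vector field `K`, `𝓛_K g = 2g`
(`IsHomotheticField 1`), all of whose integral curves are global (complete orbits,
Shlapentokh-Rothman 2023, Def. 4.1) and whose time-`Δ` flow map is the discrete homothety `Φ`
(Gundlach 1997, §2.2: CSS is the degenerate case of DSS). [cite: ShlapentokhRothman2023twisted, §1 (1.2) and Def. 4.1] -/
def IsContinuouslySelfSimilar (Z : SelfSimilarVacuumProfile.{u} n) : Prop :=
  ∃ K : Π x : Z.carrier, TangentSpace (𝓡 4) x, Z.metric.IsHomotheticField 1 K ∧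
    ∀ x, ∃ γ : ℝ → Z.carrier, IsMIntegralCurve γ K ∧ γ 0 = x ∧ γ Z.logScale = Z.dilation x

/-- The **chart representative of the metric** near `x`: the components
`((extChartAt x)⁻¹)^* g` on `E4` (honest functions of the coordinates, as in
`Spacetime.deviation` of `KerrConvergence.lean`). [folklore] -/
def metricInChart (x : Z.carrier) : E4 → E4 →L[ℝ] E4 →L[ℝ] ℝ := fun y ↦
  (show E4 →L[ℝ] E4 →L[ℝ] ℝ from
    pullbackBilin (I := 𝓡 4) (I' := 𝓘(ℝ, E4)) (extChartAt (𝓡 4) x).symm Z.metric.val y)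

/-- **Hölder regularity across the cone**: the metric is `C^{1,α}` across `𝒩` in the sense that
near every cone point, in the chart at that point, the first coordinate derivatives of the metric
components `z ↦ g_z(v, w)` are `α`-Hölder (uniformly on a neighbourhood, for each pair `v, w`).
With `n = 1` this is the "threshold-kinked" class of the known vacuum examples: `g ∈ C^{1,cε²}`
across `{v̂ = 0}` (RSR 2023, Thm. 1), the analogue of Christodoulou's `C^{1,k²/(1−k²)}`
(RSR 2023, Thm. 1.1). [cite: RodnianskiShlapentokhRothman2023, Thm. 1] -/
def IsHolderAcrossCone (Z : SelfSimilarVacuumProfile.{u} n) (α : ℝ≥0) : Prop :=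
  ∀ x ∈ Z.cone, ∃ U ∈ 𝓝 (extChartAt (𝓡 4) x x), ∀ v w : E4, ∃ C : ℝ≥0, ∀ y ∈ U, ∀ y' ∈ U,
    ‖fderiv ℝ (fun z ↦ Z.metricInChart x z v w) y - fderiv ℝ (fun z ↦ Z.metricInChart x z v w) y'‖
      ≤ C * ‖y - y'‖ ^ (α : ℝ)

/-- A profile of the **regular-horizon class** (`n = ∞`: the metric is `C^∞` across the cone) is a
spacetime in the sense of the tree (`Spacetime 4`, Hawking–Ellis 1973, §3.1). [cite: HawkingEllis1973, §3.1] -/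
def toSpacetime (Z : SelfSimilarVacuumProfile.{u} ∞) : Spacetime.{u} 4 where
  toLorentzianManifold := Z.toLorentzianManifold
  timeOrientation := Z.timeOrientation

/-- The carrier of the associated spacetime is the carrier of the profile. [folklore] -/
@[simp] lemma toSpacetime_carrier (Z : SelfSimilarVacuumProfile.{u} ∞) :
    Z.toSpacetime.carrier = Z.carrier := rfl

/-- A smooth profile's spacetime is Ricci-flat (vacuum). Shlapentokh-Rothman 2023, §1, (1.1). [cite: ShlapentokhRothman2023twisted, §1 (1.1)] -/
theorem isRicciFlat_toSpacetime (Z : SelfSimilarVacuumProfile.{u} ∞) :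
    Z.toSpacetime.metric.IsRicciFlat :=
  Z.isRicciFlat (WithTop.coe_le_coe.2 le_top : ((2 : ℕ∞) : ℕ∞ω) ≤ ∞)

end SelfSimilarVacuumProfile

/-- A **continuously self-similar vacuum profile**: a self-similar vacuum profile together with a
homothetic vector field `K`, `𝓛_K g = 2g`, whose integral curves are global and whose time-`Δ`
flow map is the discrete homothety `Φ` (so `Φ = φ_Δ` and the `K`-orbits are complete).
Shlapentokh-Rothman 2023, §1, (1.2) and Def. 4.1; Gundlach–Martín-García 2007, §2.2. Examples
(informal): Fefferman–Graham self-similar vacuum solutions (`K` normal to the cone, RSR 2023,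
§1.4), the twisted self-similar solutions underlying RSR's naked singularities (`K` tangent, not
normal), and — flat — Minkowski space minus a point with `K = x^μ ∂_μ`. [cite: ShlapentokhRothman2023twisted, §1 (1.2) and Def. 4.1] -/
structure ContinuouslySelfSimilarVacuumProfile (n : ℕ∞ω) [Fact (1 ≤ n)]
    extends SelfSimilarVacuumProfile.{u} n where
  /-- The homothetic vector field `K`. -/
  homotheticField : Π x : carrier, TangentSpace (𝓡 4) x
  /-- `𝓛_K g = 2g`. -/
  isHomotheticField : metric.IsHomotheticField 1 homotheticField
  /-- Every point lies on a global integral curve of `K` whose time-`Δ` value is `Φ` of the point. -/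
  exists_isMIntegralCurve : ∀ x, ∃ γ : ℝ → carrier,
    IsMIntegralCurve γ homotheticField ∧ γ 0 = x ∧ γ logScale = dilation x

namespace ContinuouslySelfSimilarVacuumProfile

variable {n : ℕ∞ω} [Fact (1 ≤ n)] (Z : ContinuouslySelfSimilarVacuumProfile.{u} n)

/-- The underlying profile of a CSS profile is continuously self-similar. [cite: ShlapentokhRothman2023twisted, Def. 4.1] -/
theorem isContinuouslySelfSimilar : Z.toSelfSimilarVacuumProfile.IsContinuouslySelfSimilar :=
  ⟨Z.homotheticField, Z.isHomotheticField, Z.exists_isMIntegralCurve⟩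

/-- `K` is a `C^n` vector field. [cite: ShlapentokhRothman2023twisted, Def. 4.1] -/
lemma contMDiff_homotheticField :
    ContMDiff (𝓡 4) (𝓡 4).tangent n
      (fun x ↦ (TotalSpace.mk' E4 x (Z.homotheticField x) : TangentBundle (𝓡 4) Z.carrier)) :=
  Z.isHomotheticField.contMDiff

end ContinuouslySelfSimilarVacuumProfile

namespace SelfSimilarVacuumProfile

variable {n : ℕ∞ω} [Fact (1 ≤ n)]

/-- A profile is continuously self-similar iff it underlies a CSS profile. [folklore] -/
theorem isContinuouslySelfSimilar_iff (Z : SelfSimilarVacuumProfile.{u} n) :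
    Z.IsContinuouslySelfSimilar ↔
      ∃ Z' : ContinuouslySelfSimilarVacuumProfile.{u} n, Z'.toSelfSimilarVacuumProfile = Z :=
  ⟨fun ⟨K, hK, hγ⟩ ↦ ⟨⟨Z, K, hK, hγ⟩, rfl⟩, fun ⟨Z', hZ'⟩ ↦ hZ' ▸ Z'.isContinuouslySelfSimilar⟩

end SelfSimilarVacuumProfile

end Literature.Geometry.Lorentzian

end
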